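import Literature.Computability.FineGrained.IPRenameLookup
import Literature.Computability.FineGrained.SchoeningCoinTransducer
import Literature.Computability.FineGrained.SchoeningCoinAlgorithm
import HarnessLib

/-!
# Schöning's random-walk algorithm for `k`-SAT, machine II: the register file and the routines

Topic `Literature/Computability/FineGrained`; machine half of the line `SchoeningCoin*` towards the
named fact `Literature.Computability.FineGrained.schoening` (Schöning, FOCS 1999, Theorem). The
main stage of the machine is a structured stack program over `Γ'`
(`Literature.Computability.Complexity.ACom`, `SymbolPrograms.lean`: exact costs, compiled onto
Mathlib's `Turing.FinTM2` by `ACom.exists_computesInTime`) computing the coin-string function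
`SchoeningCoin.run` of `SchoeningCoinAlgorithm.lean` on the layout `inputW φ r` of
`SchoeningCoinTransducer.lean`. It is written over the register file `IPRenameM.Reg` of the
renaming machine of Impagliazzo–Paturi's Lemma 2 (`IPRenameLookup.lean`) so as to reuse its
verified lookup routine `IPRenameM.lookupVal` (`runs_lookupVal`): the current assignment is held
as a literal list `cbody L` (`Sparsifier.cbody`: polarity bit, index bits, comma) in the tuple
register `vt`, read by first match exactly as `SchoeningCoin.Asg.val` (`lookupB_eq_val`), so that
a flip is the prepending of one literal and the random initial assignment the prepending of one
literal per occurrence.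

* `MSt`, `st` — the registers used, as a store family over `IPRenameM.RStore` (all other
  registers empty) with its `simp` lemmas;
* `coinTree d f` / `runs_coinTree` — read `d` coins from `inp` as a number `u < 2^d` (least
  significant first, `SchoeningCoin.readU`) and continue with `f u`;
* `pick u` / `runs_pick` — prepend to `vt` the flipped literal of the `u`-th entry of the staged
  violated clause in `cl` (nothing if there is none), by the generic `forEach`
  (`IPRenameLoops.lean`);
* `mkCy` / `runs_mkCy` — the step counter `blank^(2k·#occurrences + 1)` (`SchoeningCoin.sOf`);
* `initPass` / `runs_initPass` — the random initial assignment: one coin per occurrence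
  (`SchoeningCoin.initL`).

## References

* U. Schöning, *A probabilistic algorithm for k-SAT and constraint satisfaction problems*, Proc.
  40th FOCS (1999) 410–414 [key `SchoeningFOCS1999`].
* T. Nipkow, G. Klein, *Concrete Semantics with Isabelle/HOL*, Springer 2014, Ch. 7 (big-step
  reasoning about loops, as in `SymbolPrograms.lean`).
-/

namespace Literature.Computability.FineGrained.SchoeningCoin

open _root_.Computability Complexity Complexity.ACom IPRenameM Sparsifier

/-! ### The registers used, as a store family -/

/-- The registers of the Schöning program (inside `IPRenameM.Reg`): input/coins `inp`, output
`out`, phase `md`, the formula reversed (`acc`) and in order (`fam`, working copy `fam2`), the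
assignment `vt`, the probe `pr`, the looked-up value `val`, the clause flag `res`, the staged clause
reversed (`clR`) and in order (`cl`), the flags `fl` (violated clause found) and `done` (satisfying
assignment found), the step counter `cy`, the entry counter `iu`, collectors `c`, `c2` and scratch
`t1`, `t2`. [folklore] -/
structure MSt where
  (inp out md acc fam fam2 vt pr val res clR cl fl done cy iu c c2 t1 t2 : List Γ')

/-- The store of the program registers `ρ` (every other register of `IPRenameM.Reg` empty).
[folklore] -/
def st (ρ : MSt) : RStore := fun r =>
    if r = kr KR.inp then ρ.inp else
    if r = kr KR.out then ρ.out else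
    if r = kr KR.md then ρ.md else
    if r = kr KR.hdr then ρ.acc else
    if r = kr KR.fam then ρ.fam else
    if r = kr KR.fam2 then ρ.fam2 else
    if r = tb TB.vt then ρ.vt else
    if r = kr KR.pr then ρ.pr else
    if r = kr KR.val then ρ.val else
    if r = kr KR.res then ρ.res else
    if r = kr KR.cl then ρ.clR else
    if r = kr KR.clw then ρ.cl else
    if r = kr KR.fl then ρ.fl else
    if r = kr KR.done then ρ.done else
    if r = tb TB.cy then ρ.cy else
    if r = kr KR.iu then ρ.iu else
    if r = kr KR.c then ρ.c else
    if r = kr KR.c2 then ρ.c2 else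
    if r = kr KR.t1 then ρ.t1 else
    if r = kr KR.t2 then ρ.t2 else
    []

/-- The all-empty register file. [folklore] -/
def MSt.zero : MSt := ⟨[], [], [], [], [], [], [], [], [], [], [], [], [], [], [], [], [], [], [], []⟩

section StLemmas

variable (ρ : MSt) (w : List Γ')

/-- Reading `inp`. [folklore] -/
@[simp] theorem st_inp : st ρ (kr KR.inp) = ρ.inp := by simp [st]
/-- Reading `out`. [folklore] -/
@[simp] theorem st_out : st ρ (kr KR.out) = ρ.out := by simp [st]
/-- Reading `md`. [folklore] -/
@[simp] theorem st_md : st ρ (kr KR.md) = ρ.md := by simp [st]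
/-- Reading `acc`. [folklore] -/
@[simp] theorem st_acc : st ρ (kr KR.hdr) = ρ.acc := by simp [st]
/-- Reading `fam`. [folklore] -/
@[simp] theorem st_fam : st ρ (kr KR.fam) = ρ.fam := by simp [st]
/-- Reading `fam2`. [folklore] -/
@[simp] theorem st_fam2 : st ρ (kr KR.fam2) = ρ.fam2 := by simp [st]
/-- Reading `vt`. [folklore] -/
@[simp] theorem st_vt : st ρ (tb TB.vt) = ρ.vt := by simp [st]
/-- Reading `pr`. [folklore] -/
@[simp] theorem st_pr : st ρ (kr KR.pr) = ρ.pr := by simp [st]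
/-- Reading `val`. [folklore] -/
@[simp] theorem st_val : st ρ (kr KR.val) = ρ.val := by simp [st]
/-- Reading `res`. [folklore] -/
@[simp] theorem st_res : st ρ (kr KR.res) = ρ.res := by simp [st]
/-- Reading `clR`. [folklore] -/
@[simp] theorem st_clR : st ρ (kr KR.cl) = ρ.clR := by simp [st]
/-- Reading `cl`. [folklore] -/
@[simp] theorem st_cl : st ρ (kr KR.clw) = ρ.cl := by simp [st]
/-- Reading `fl`. [folklore] -/
@[simp] theorem st_fl : st ρ (kr KR.fl) = ρ.fl := by simp [st]
/-- Reading `done`. [folklore] -/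
@[simp] theorem st_done : st ρ (kr KR.done) = ρ.done := by simp [st]
/-- Reading `cy`. [folklore] -/
@[simp] theorem st_cy : st ρ (tb TB.cy) = ρ.cy := by simp [st]
/-- Reading `iu`. [folklore] -/
@[simp] theorem st_iu : st ρ (kr KR.iu) = ρ.iu := by simp [st]
/-- Reading `c`. [folklore] -/
@[simp] theorem st_c : st ρ (kr KR.c) = ρ.c := by simp [st]
/-- Reading `c2`. [folklore] -/
@[simp] theorem st_c2 : st ρ (kr KR.c2) = ρ.c2 := by simp [st]
/-- Reading `t1`. [folklore] -/
@[simp] theorem st_t1 : st ρ (kr KR.t1) = ρ.t1 := by simp [st]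
/-- Reading `t2`. [folklore] -/
@[simp] theorem st_t2 : st ρ (kr KR.t2) = ρ.t2 := by simp [st]
/-- The scratch register `vw` of the lookup routine is empty. [folklore] -/
@[simp] theorem st_vw : st ρ (kr KR.vw) = [] := by simp [st]
/-- The scratch register `fnd` of the lookup routine is empty. [folklore] -/
@[simp] theorem st_fnd : st ρ (kr KR.fnd) = [] := by simp [st]
/-- The scratch register `ex` of the lookup routine is empty. [folklore] -/
@[simp] theorem st_ex : st ρ (kr KR.ex) = [] := by simp [st]
/-- The scratch register `eb` of the lookup routine is empty. [folklore] -/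
@[simp] theorem st_eb : st ρ (kr KR.eb) = [] := by simp [st]
/-- The scratch register `lmd` of the lookup routine is empty. [folklore] -/
@[simp] theorem st_lmd : st ρ (kr KR.lmd) = [] := by simp [st]
/-- The scratch register `ne` of the lookup routine is empty. [folklore] -/
@[simp] theorem st_ne : st ρ (kr KR.ne) = [] := by simp [st]
/-- The scratch register `x2` of the lookup routine is empty. [folklore] -/
@[simp] theorem st_x2 : st ρ (kr KR.x2) = [] := by simp [st]

/-- Updating `inp`. [folklore] -/
@[simp] theorem update_st_inp : Function.update (st ρ) (kr KR.inp) w = st { ρ with inp := w } := by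
  funext r; by_cases h : r = kr KR.inp
  · subst h; simp
  · rw [Function.update_of_ne h]; simp [st, h]
/-- Updating `out`. [folklore] -/
@[simp] theorem update_st_out : Function.update (st ρ) (kr KR.out) w = st { ρ with out := w } := by
  funext r; by_cases h : r = kr KR.out
  · subst h; simp
  · rw [Function.update_of_ne h]; simp [st, h]
/-- Updating `md`. [folklore] -/
@[simp] theorem update_st_md : Function.update (st ρ) (kr KR.md) w = st { ρ with md := w } := by
  funext r; by_cases h : r = kr KR.md
  · subst h; simp
  · rw [Function.update_of_ne h]; simp [st, h]
/-- Updating `acc`. [folklore] -/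
@[simp] theorem update_st_acc : Function.update (st ρ) (kr KR.hdr) w = st { ρ with acc := w } := by
  funext r; by_cases h : r = kr KR.hdr
  · subst h; simp
  · rw [Function.update_of_ne h]; simp [st, h]
/-- Updating `fam`. [folklore] -/
@[simp] theorem update_st_fam : Function.update (st ρ) (kr KR.fam) w = st { ρ with fam := w } := by
  funext r; by_cases h : r = kr KR.fam
  · subst h; simp
  · rw [Function.update_of_ne h]; simp [st, h]
/-- Updating `fam2`. [folklore] -/
@[simp] theorem update_st_fam2 : Function.update (st ρ) (kr KR.fam2) w = st { ρ with fam2 := w } := by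
  funext r; by_cases h : r = kr KR.fam2
  · subst h; simp
  · rw [Function.update_of_ne h]; simp [st, h]
/-- Updating `vt`. [folklore] -/
@[simp] theorem update_st_vt : Function.update (st ρ) (tb TB.vt) w = st { ρ with vt := w } := by
  funext r; by_cases h : r = tb TB.vt
  · subst h; simp
  · rw [Function.update_of_ne h]; simp [st, h]
/-- Updating `pr`. [folklore] -/
@[simp] theorem update_st_pr : Function.update (st ρ) (kr KR.pr) w = st { ρ with pr := w } := by
  funext r; by_cases h : r = kr KR.pr
  · subst h; simp
  · rw [Function.update_of_ne h]; simp [st, h]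
/-- Updating `val`. [folklore] -/
@[simp] theorem update_st_val : Function.update (st ρ) (kr KR.val) w = st { ρ with val := w } := by
  funext r; by_cases h : r = kr KR.val
  · subst h; simp
  · rw [Function.update_of_ne h]; simp [st, h]
/-- Updating `res`. [folklore] -/
@[simp] theorem update_st_res : Function.update (st ρ) (kr KR.res) w = st { ρ with res := w } := by
  funext r; by_cases h : r = kr KR.res
  · subst h; simp
  · rw [Function.update_of_ne h]; simp [st, h]
/-- Updating `clR`. [folklore] -/
@[simp] theorem update_st_clR : Function.update (st ρ) (kr KR.cl) w = st { ρ with clR := w } := by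
  funext r; by_cases h : r = kr KR.cl
  · subst h; simp
  · rw [Function.update_of_ne h]; simp [st, h]
/-- Updating `cl`. [folklore] -/
@[simp] theorem update_st_cl : Function.update (st ρ) (kr KR.clw) w = st { ρ with cl := w } := by
  funext r; by_cases h : r = kr KR.clw
  · subst h; simp
  · rw [Function.update_of_ne h]; simp [st, h]
/-- Updating `fl`. [folklore] -/
@[simp] theorem update_st_fl : Function.update (st ρ) (kr KR.fl) w = st { ρ with fl := w } := by
  funext r; by_cases h : r = kr KR.fl
  · subst h; simp
  · rw [Function.update_of_ne h]; simp [st, h]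
/-- Updating `done`. [folklore] -/
@[simp] theorem update_st_done : Function.update (st ρ) (kr KR.done) w = st { ρ with done := w } := by
  funext r; by_cases h : r = kr KR.done
  · subst h; simp
  · rw [Function.update_of_ne h]; simp [st, h]
/-- Updating `cy`. [folklore] -/
@[simp] theorem update_st_cy : Function.update (st ρ) (tb TB.cy) w = st { ρ with cy := w } := by
  funext r; by_cases h : r = tb TB.cy
  · subst h; simp
  · rw [Function.update_of_ne h]; simp [st, h]
/-- Updating `iu`. [folklore] -/
@[simp] theorem update_st_iu : Function.update (st ρ) (kr KR.iu) w = st { ρ with iu := w } := by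
  funext r; by_cases h : r = kr KR.iu
  · subst h; simp
  · rw [Function.update_of_ne h]; simp [st, h]
/-- Updating `c`. [folklore] -/
@[simp] theorem update_st_c : Function.update (st ρ) (kr KR.c) w = st { ρ with c := w } := by
  funext r; by_cases h : r = kr KR.c
  · subst h; simp
  · rw [Function.update_of_ne h]; simp [st, h]
/-- Updating `c2`. [folklore] -/
@[simp] theorem update_st_c2 : Function.update (st ρ) (kr KR.c2) w = st { ρ with c2 := w } := by
  funext r; by_cases h : r = kr KR.c2
  · subst h; simp
  · rw [Function.update_of_ne h]; simp [st, h]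
/-- Updating `t1`. [folklore] -/
@[simp] theorem update_st_t1 : Function.update (st ρ) (kr KR.t1) w = st { ρ with t1 := w } := by
  funext r; by_cases h : r = kr KR.t1
  · subst h; simp
  · rw [Function.update_of_ne h]; simp [st, h]
/-- Updating `t2`. [folklore] -/
@[simp] theorem update_st_t2 : Function.update (st ρ) (kr KR.t2) w = st { ρ with t2 := w } := by
  funext r; by_cases h : r = kr KR.t2
  · subst h; simp
  · rw [Function.update_of_ne h]; simp [st, h]

end StLemmas

/-- The zero store is the empty store. [folklore] -/
theorem st_zero : st MSt.zero = fun _ => [] := by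
  funext r; simp [st, MSt.zero]

/-- The initial store of the machine: the input word in `inp`. [folklore] -/
theorem single_inp (z : List Γ') : AStore.single (kr KR.inp) z = st { MSt.zero with inp := z } := by
  rw [AStore.single_eq_update, ← st_zero, update_st_inp]

/-- The final store of the machine: the answer in `out`. [folklore] -/
theorem single_out (z : List Γ') : AStore.single (kr KR.out) z = st { MSt.zero with out := z } := by
  rw [AStore.single_eq_update, ← st_zero, update_st_out]


/-! ### Reading coins -/

/-- `coinTree d f`: pop `d` symbols from `inp` — coins; an exhausted register or a symbol other
than `bit true` reads as `0` — and continue with `f u`, `u < 2^d` the number read least significant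
coin first (`SchoeningCoin.readU`). The tree has `2^d` leaves (the machine depends on `k`). [folklore] -/
def coinTree : ℕ → (ℕ → RProg) → RProg
  | 0, f => f 0
  | d + 1, f => pop (kr KR.inp) fun o => match o with
      | some (Γ'.bit true) => coinTree d fun u => f (1 + 2 * u)
      | _ => coinTree d fun u => f (2 * u)

/-- **Specification of `coinTree`**: with the coins `cs` (as bits) in `inp`, the tree runs the leaf
of `(readU d cs).1` on the store with the remaining coins, at cost `2d` plus the leaf's. [folklore] -/
theorem runs_coinTree (C : ℕ) : ∀ (d : ℕ) (f : ℕ → RProg) (F : ℕ → MSt → MSt),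
    (∀ (u : ℕ) (ρ : MSt), Runs (f u) (st ρ) (st (F u ρ)) C) →
    ∀ (ρ : MSt) (cs : List Bool),
      Runs (coinTree d f) (st { ρ with inp := cs.map Γ'.bit })
        (st (F (readU d cs).1 { ρ with inp := (readU d cs).2.map Γ'.bit })) (2 * d + C)
  | 0, f, F, hf, ρ, cs => by simpa [coinTree, readU] using hf 0 { ρ with inp := cs.map Γ'.bit }
  | d + 1, f, F, hf, ρ, cs => by
    unfold coinTree
    rw [show 2 * (d + 1) + C = (2 * d + C) + 2 by ring]
    cases cs with
    | nil =>
      have ih := runs_coinTree C d (fun u => f (2 * u)) (fun u => F (2 * u)) (fun u ρ => hf _ ρ) ρ []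
      refine Runs.pop_nil (by simp) ?_
      simpa [readU, popD] using ih
    | cons b cs =>
      cases b with
      | true =>
        have ih := runs_coinTree C d (fun u => f (1 + 2 * u)) (fun u => F (1 + 2 * u)) (fun u ρ => hf _ ρ) ρ cs
        refine Runs.pop_cons
          (show st { ρ with inp := (true :: cs).map Γ'.bit } (kr KR.inp) = Γ'.bit true :: cs.map Γ'.bit by simp) ?_
        simpa [readU, popD] using ih
      | false =>
        have ih := runs_coinTree C d (fun u => f (2 * u)) (fun u => F (2 * u)) (fun u ρ => hf _ ρ) ρ cs
        refine Runs.pop_cons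
          (show st { ρ with inp := (false :: cs).map Γ'.bit } (kr KR.inp) = Γ'.bit false :: cs.map Γ'.bit by simp) ?_
        simpa [readU, popD] using ih


/-! ### Words of the formula and of the assignment -/

variable {k : ℕ}

/-- The reversed index bits with the polarity on top: the probe register after the bits of a
literal of the layout have been pushed. [folklore] -/
theorem reverse_bits_pol (l : ℕ × Bool) :
    ((encodeNat l.1).map Γ'.bit ++ [Γ'.bit l.2]).reverse = Γ'.bit l.2 :: rbits l.1 := by
  simp [rbits]

/-- `cbody` of a cons, in the literal format of `vt`. [folklore] -/
theorem cbody_cons_eq (x : ℕ) (b : Bool) (L : List Lit) :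
    cbody ((x, b) :: L) = Γ'.bit b :: ((encodeNat x).map Γ'.bit ++ Γ'.comma :: cbody L) := by
  simp [cbody, KCNF.encodeLiteral]

/-- The lookup of the toolkit is the reading of `SchoeningCoinAlgorithm.lean`. [folklore] -/
theorem lookupB_eq_val (L : List Lit) (x : ℕ) : lookupB L x = Asg.val L x := rfl

/-- A literal word has one comma. [folklore] -/
theorem count_comma_litW (l : ℕ × Bool) : (litW l).count Γ'.comma = 1 := by
  unfold litW
  rw [List.count_append, List.count_eq_zero.2 (by simp)]
  simp

/-- A clause word has one comma per literal. [folklore] -/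
theorem count_comma_clauseW (c : List (ℕ × Bool)) : (clauseW c).count Γ'.comma = c.length := by
  unfold clauseW
  rw [List.count_cons, List.count_append]
  have : (c.flatMap litW).count Γ'.comma = c.length := by
    induction c with
    | nil => rfl
    | cons l c ih => rw [List.flatMap_cons, List.count_append, ih, count_comma_litW, List.length_cons, Nat.add_comm]
  rw [this]
  simp

/-- The number of commas of the formula word is the number of occurrences. [folklore] -/
theorem count_comma_formW (φ : KCNF k) : (formW φ).count Γ'.comma = (occs φ).length := by
  unfold formW occs
  induction φ.clauses with
  | nil => rfl
  | cons c cs ih =>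
    rw [List.flatMap_cons, List.count_append, ih, List.flatMap_cons, List.length_append, List.length_map,
      count_comma_clauseW]

/-- `initL` over a concatenation of occurrence lists. [folklore] -/
theorem initL_append_occs : ∀ (xs ys : List ℕ) (L : Asg) (r : List Bool),
    initL (xs ++ ys) L r = initL ys (initL xs L r).1 (initL xs L r).2
  | [], ys, L, r => rfl
  | x :: xs, ys, L, r => by rw [List.cons_append, initL, initL, initL_append_occs xs ys]

/-! ### The step counter -/

/-- Counting commas past another symbol. [folklore] -/
theorem count_comma_cons_of_ne {a : Γ'} (h : a ≠ Γ'.comma) (w : List Γ') :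
    (a :: w).count Γ'.comma = w.count Γ'.comma := by
  rw [List.count_cons, beq_false_of_ne h]
  rfl

/-- Body of the counter loop: `2k` ticks per comma of the formula copy. [folklore] -/
def cyBody (k : ℕ) (a : Γ') : RProg :=
  if a = Γ'.comma then pushList (tb TB.cy) (List.replicate (2 * k) Γ'.blank) else skip

/-- `mkCy k`: lay the step counter `blank^(2k · #occurrences + 1)` on `cy` (`SchoeningCoin.sOf`),
reading a copy of the formula. [folklore] -/
def mkCy (k : ℕ) : RProg :=
  copyToG (kr KR.fam) (kr KR.fam2) (kr KR.t1) (kr KR.t2) ;; loop (kr KR.fam2) (cyBody k) ;;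
    push (tb TB.cy) Γ'.blank

/-- **Specification of `mkCy`.** [folklore] -/
theorem runs_mkCy (k : ℕ) (ρ : MSt) (hfam2 : ρ.fam2 = []) (ht1 : ρ.t1 = []) (ht2 : ρ.t2 = [])
    (hcy : ρ.cy = []) :
    Runs (mkCy k) (st ρ) (st { ρ with cy := List.replicate (2 * k * (ρ.fam.count Γ'.comma) + 1) Γ'.blank })
      ((2 * k + 12) * ρ.fam.length + 5) := by
  unfold mkCy
  have h1 := runs_copyToG (a := kr KR.fam) (b := kr KR.fam2) (t₁ := kr KR.t1) (t₂ := kr KR.t2)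
    (by decide) (by decide) (by decide) (by decide) (by decide) (by decide) (st ρ)
    (by simp [ht1]) (by simp [ht2]) (by simp [hfam2])
  simp only [st_fam, update_st_fam2] at h1
  have h2 := runs_loop_inv (k := kr KR.fam2) (f := cyBody k)
    (fun done rest => st { ρ with fam2 := rest, cy := List.replicate (2 * k * done.count Γ'.comma) Γ'.blank })
    (fun _ _ => True) (2 * k) (fun _ _ _ => by simp)
    (fun done a rest _ => ⟨trivial, by
      unfold cyBody
      by_cases ha : a = Γ'.comma
      · subst ha
        refine (runs_pushList (tb TB.cy) _ _).of_eq ?_ (by simp)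
        simp only [update_st_fam2, st_cy, update_st_cy, List.reverse_replicate, List.count_cons_self,
          ← List.replicate_add]
        congr 2; ring
      · rw [if_neg ha]
        refine (Runs.skip (Γ := Γ') (ι := Reg) _).of_eq ?_ (by omega)
        simp only [update_st_fam2]
        rw [count_comma_cons_of_ne ha]⟩)
    ρ.fam [] trivial
  simp only [List.count_nil, Nat.mul_zero, List.replicate_zero, List.append_nil, List.count_reverse] at h2
  have e0 : st { ρ with fam2 := ρ.fam, cy := ([] : List Γ') } = st { ρ with fam2 := ρ.fam } := by rw [← hcy]
  rw [e0] at h2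
  have h3 := Runs.push (tb TB.cy) Γ'.blank (st { ρ with fam2 := ([] : List Γ'), cy := List.replicate (2 * k * ρ.fam.count Γ'.comma) Γ'.blank })
  simp only [st_cy, update_st_cy] at h3
  refine (h1.seq (h2.seq h3)).of_eq ?_ ?_
  · rw [List.replicate_succ]
    cases ρ; simp only at hfam2; subst hfam2; rfl
  · ring_nf; omega

/-! ### The random initial assignment -/

/-- At the comma of a literal of the formula copy during initialisation: drop the polarity (on
top of `pr`), pop a coin, and prepend the literal "variable := coin" to the assignment `vt`
(comma, then the index bits poured from `pr`, then the value bit). [cite: SchoeningFOCS1999, Theorem (the algorithm: a uniformly random initial assignment)] -/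
def initLit : RProg :=
  pop (kr KR.pr) fun _ =>
    pop (kr KR.inp) fun o =>
      push (tb TB.vt) Γ'.comma ;; pour (kr KR.pr) (tb TB.vt) ;;
        push (tb TB.vt) (match o with | some (Γ'.bit true) => Γ'.bit true | _ => Γ'.bit false)

/-- Body of the initialisation pass: index and polarity bits go to `pr`, the comma closes a literal.
[folklore] -/
def initBody (a : Γ') : RProg :=
  match a with
  | Γ'.bit b => push (kr KR.pr) (Γ'.bit b)
  | Γ'.comma => initLit
  | _ => skip

/-- `initPass`: the random initial assignment, one coin per occurrence of a variable, over a copy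
of the formula (`SchoeningCoin.initL`). [cite: SchoeningFOCS1999, Theorem (the algorithm)] -/
def initPass : RProg :=
  copyToG (kr KR.fam) (kr KR.fam2) (kr KR.t1) (kr KR.t2) ;; loop (kr KR.fam2) initBody

/-- The coin read by `initLit` from the top of `inp`. [folklore] -/
theorem initLit_coin (cs : List Bool) :
    (match (cs.map Γ'.bit).head? with | some (Γ'.bit true) => Γ'.bit true | _ => Γ'.bit false) =
      Γ'.bit (popD cs).1 := by
  rcases cs with _ | ⟨_ | _, cs⟩ <;> rfl

/-- **One literal of the initialisation pass.** [folklore] -/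
theorem segRuns_init_lit (ρ : MSt) (l : ℕ × Bool) (rest : List Γ') (L : List Lit) (cs : List Bool)
    (hpr : ρ.pr = []) :
    SegRuns (kr KR.fam2) initBody (litW l)
      (st { ρ with fam2 := litW l ++ rest, vt := cbody L, inp := cs.map Γ'.bit })
      (st { ρ with fam2 := rest, vt := cbody ((l.1, (popD cs).1) :: L), inp := (popD cs).2.map Γ'.bit })
      (6 * (encodeNat l.1).length + 18) := by
  -- the bits (index, then polarity) go to `pr`
  have hbits : ∀ (bs : List Γ') (hbs : ∀ a ∈ bs, ∃ b, a = Γ'.bit b) (pr₀ rest' : List Γ') (vt inp : List Γ'),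
      SegRuns (kr KR.fam2) initBody bs
        (st { ρ with fam2 := bs ++ rest', pr := pr₀, vt := vt, inp := inp })
        (st { ρ with fam2 := rest', pr := bs.reverse ++ pr₀, vt := vt, inp := inp }) (3 * bs.length) := by
    intro bs
    induction bs with
    | nil => intro _ pr₀ rest' vt inp; simpa using SegRuns.nil (kr KR.fam2) initBody _
    | cons a bs ih =>
      intro hbs pr₀ rest' vt inp
      obtain ⟨b, rfl⟩ := hbs a (by simp)
      have h1 : Runs (initBody (Γ'.bit b)) (st { ρ with fam2 := bs ++ rest', pr := pr₀, vt := vt, inp := inp })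
          (st { ρ with fam2 := bs ++ rest', pr := Γ'.bit b :: pr₀, vt := vt, inp := inp }) 1 := by
        refine (Runs.push (kr KR.pr) (Γ'.bit b) _).of_eq ?_ le_rfl
        simp
      have h2 := ih (fun a ha => hbs a (by simp [ha])) (Γ'.bit b :: pr₀) rest' vt inp
      refine (SegRuns.cons' (st_fam2 _) (by simp) h1 h2).of_eq (by simp) ?_
      simp only [List.length_cons]; omega
  have hb := hbits ((encodeNat l.1).map Γ'.bit ++ [Γ'.bit l.2]) (by
      intro a ha; simp only [List.mem_append, List.mem_map, List.mem_singleton] at ha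
      rcases ha with ⟨b, _, rfl⟩ | rfl <;> exact ⟨_, rfl⟩)
    [] (Γ'.comma :: rest) (cbody L) (cs.map Γ'.bit)
  rw [List.append_nil, reverse_bits_pol] at hb
  -- the comma: `initLit`
  have hc : Runs (initBody Γ'.comma)
      (st { ρ with fam2 := rest, pr := Γ'.bit l.2 :: rbits l.1, vt := cbody L, inp := cs.map Γ'.bit })
      (st { ρ with fam2 := rest, vt := cbody ((l.1, (popD cs).1) :: L), inp := (popD cs).2.map Γ'.bit })
      (3 * (encodeNat l.1).length + 8) := by
    show Runs initLit _ _ _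
    unfold initLit
    -- after the two pops: the common continuation
    have hcont : ∀ (o : Option Γ') (c : Bool),
        (match o with | some (Γ'.bit true) => Γ'.bit true | _ => Γ'.bit false) = Γ'.bit c →
        ∀ inp' : List Γ',
        Runs (push (tb TB.vt) Γ'.comma ;; pour (kr KR.pr) (tb TB.vt) ;;
            push (tb TB.vt) (match o with | some (Γ'.bit true) => Γ'.bit true | _ => Γ'.bit false))
          (st { ρ with fam2 := rest, pr := rbits l.1, vt := cbody L, inp := inp' })
          (st { ρ with fam2 := rest, pr := [], vt := cbody ((l.1, c) :: L), inp := inp' })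
          (3 * (encodeNat l.1).length + 4) := by
      intro o c ho inp'
      rw [ho]
      have p1 := Runs.push (tb TB.vt) Γ'.comma (st { ρ with fam2 := rest, pr := rbits l.1, vt := cbody L, inp := inp' })
      simp only [st_vt, update_st_vt] at p1
      have p2 := runs_pour (a := kr KR.pr) (b := tb TB.vt) (by decide)
        (st { ρ with fam2 := rest, pr := rbits l.1, vt := Γ'.comma :: cbody L, inp := inp' })
      simp only [st_pr, st_vt, update_st_pr, update_st_vt] at p2
      have p3 := Runs.push (tb TB.vt) (Γ'.bit c)
        (st { ρ with fam2 := rest, pr := ([] : List Γ'), vt := (rbits l.1).reverse ++ Γ'.comma :: cbody L, inp := inp' })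
      simp only [st_vt, update_st_vt] at p3
      refine (p1.seq (p2.seq p3)).of_eq ?_ ?_
      · simp [cbody_cons_eq, rbits]
      · simp [rbits]; omega
    have e : st { ρ with fam2 := rest, vt := cbody ((l.1, (popD cs).1) :: L), inp := (popD cs).2.map Γ'.bit } =
        st { ρ with
          fam2 := rest, pr := ([] : List Γ'), vt := cbody ((l.1, (popD cs).1) :: L)
          inp := (popD cs).2.map Γ'.bit } := by
      rw [← hpr]
    rw [e]
    refine Runs.pop_cons (st_pr _) ?_
    simp only [update_st_pr]
    cases cs with
    | nil =>
      exact (Runs.pop_nil (by simp) (hcont none false rfl _)).of_eq rfl (by omega)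
    | cons c cs =>
      cases c
      · refine (Runs.pop_cons (st_inp _) ?_).of_eq rfl (le_refl _)
        simpa only [update_st_inp, popD_cons] using hcont (some (Γ'.bit false)) false rfl _
      · refine (Runs.pop_cons (st_inp _) ?_).of_eq rfl (le_refl _)
        simpa only [update_st_inp, popD_cons] using hcont (some (Γ'.bit true)) true rfl _
  have e1 : st { ρ with fam2 := litW l ++ rest, vt := cbody L, inp := cs.map Γ'.bit } =
      st { ρ with
        fam2 := ((encodeNat l.1).map Γ'.bit ++ [Γ'.bit l.2]) ++ (Γ'.comma :: rest), pr := ([] : List Γ')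
        vt := cbody L, inp := cs.map Γ'.bit } := by
    cases ρ; simp only at hpr; subst hpr; simp [litW]
  rw [e1]
  have hfin := hb.append (SegRuns.single (st_fam2 _) (by simpa only [update_st_fam2] using hc))
  simp only [litW, List.append_assoc, List.cons_append, List.nil_append] at hfin ⊢
  refine hfin.of_eq rfl ?_
  simp; omega


/-- **The literals of a clause in the initialisation pass**: `initL` over their variables. [folklore] -/
theorem segRuns_init_lits (ρ : MSt) (hpr : ρ.pr = []) : ∀ (c : List (ℕ × Bool)) (rest : List Γ') (L : List Lit)
    (cs : List Bool),
    SegRuns (kr KR.fam2) initBody (c.flatMap litW)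
      (st { ρ with fam2 := c.flatMap litW ++ rest, vt := cbody L, inp := cs.map Γ'.bit })
      (st { ρ with
        fam2 := rest, vt := cbody (initL (c.map Prod.fst) L cs).1
        inp := (initL (c.map Prod.fst) L cs).2.map Γ'.bit })
      (9 * (c.flatMap litW).length)
  | [], rest, L, cs => by simpa [initL] using SegRuns.nil (kr KR.fam2) initBody _
  | l :: c, rest, L, cs => by
    have h1 := segRuns_init_lit ρ l (c.flatMap litW ++ rest) L cs hpr
    have h2 := segRuns_init_lits ρ hpr c rest ((l.1, (popD cs).1) :: L) (popD cs).2
    rw [List.flatMap_cons, List.append_assoc]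
    refine (h1.append h2).of_eq ?_ ?_
    · rfl
    · simp [litW]; omega

/-- **A clause in the initialisation pass.** [folklore] -/
theorem segRuns_init_clause (ρ : MSt) (hpr : ρ.pr = []) (c : List (ℕ × Bool)) (rest : List Γ') (L : List Lit)
    (cs : List Bool) :
    SegRuns (kr KR.fam2) initBody (clauseW c)
      (st { ρ with fam2 := clauseW c ++ rest, vt := cbody L, inp := cs.map Γ'.bit })
      (st { ρ with
        fam2 := rest, vt := cbody (initL (c.map Prod.fst) L cs).1
        inp := (initL (c.map Prod.fst) L cs).2.map Γ'.bit })
      (9 * (clauseW c).length) := by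
  have h0 : Runs (initBody Γ'.bra)
      (st { ρ with fam2 := c.flatMap litW ++ (Γ'.ket :: rest), vt := cbody L, inp := cs.map Γ'.bit })
      (st { ρ with fam2 := c.flatMap litW ++ (Γ'.ket :: rest), vt := cbody L, inp := cs.map Γ'.bit }) 0 :=
    Runs.skip _
  have h1 := segRuns_init_lits ρ hpr c (Γ'.ket :: rest) L cs
  have h2 : Runs (initBody Γ'.ket)
      (st { ρ with
        fam2 := rest, vt := cbody (initL (c.map Prod.fst) L cs).1
        inp := (initL (c.map Prod.fst) L cs).2.map Γ'.bit })
      (st { ρ with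
        fam2 := rest, vt := cbody (initL (c.map Prod.fst) L cs).1
        inp := (initL (c.map Prod.fst) L cs).2.map Γ'.bit }) 0 := Runs.skip _
  unfold clauseW
  refine (SegRuns.cons' (st_fam2 _) (by simp) h0
    (h1.append (SegRuns.single (st_fam2 _) (by simpa using h2)))).of_eq rfl ?_
  simp; omega

/-- **The whole formula in the initialisation pass.** [folklore] -/
theorem segRuns_init_clauses (ρ : MSt) (hpr : ρ.pr = []) : ∀ (cls : List (List (ℕ × Bool))) (rest : List Γ')
    (L : List Lit) (cs : List Bool),
    SegRuns (kr KR.fam2) initBody (cls.flatMap clauseW)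
      (st { ρ with fam2 := cls.flatMap clauseW ++ rest, vt := cbody L, inp := cs.map Γ'.bit })
      (st { ρ with
        fam2 := rest, vt := cbody (initL (cls.flatMap fun c => c.map Prod.fst) L cs).1
        inp := (initL (cls.flatMap fun c => c.map Prod.fst) L cs).2.map Γ'.bit })
      (9 * (cls.flatMap clauseW).length)
  | [], rest, L, cs => by simpa [initL] using SegRuns.nil (kr KR.fam2) initBody _
  | c :: cls, rest, L, cs => by
    have h1 := segRuns_init_clause ρ hpr c (cls.flatMap clauseW ++ rest) L cs
    have h2 := segRuns_init_clauses ρ hpr cls rest (initL (c.map Prod.fst) L cs).1 (initL (c.map Prod.fst) L cs).2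
    rw [List.flatMap_cons, List.append_assoc]
    refine (h1.append h2).of_eq ?_ ?_
    · rw [List.flatMap_cons, initL_append_occs]
    · simp; omega

/-- **Specification of `initPass`**: with the formula word in `fam` and the coins in `inp`, the
assignment register `vt` receives `cbody` of the initial literal list `(initL (occs φ) [] coins).1`
of `SchoeningCoinAlgorithm.lean`, the consumed coins leaving `inp`. [cite: SchoeningFOCS1999, Theorem (the algorithm: the random initial assignment)] -/
theorem runs_initPass (φ : KCNF k) (ρ : MSt) (cs : List Bool) (hfam : ρ.fam = formW φ) (hfam2 : ρ.fam2 = [])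
    (hvt : ρ.vt = []) (hpr : ρ.pr = []) (ht1 : ρ.t1 = []) (ht2 : ρ.t2 = []) (hinp : ρ.inp = cs.map Γ'.bit) :
    Runs initPass (st ρ)
      (st { ρ with vt := cbody (initL (occs φ) [] cs).1, inp := (initL (occs φ) [] cs).2.map Γ'.bit })
      (19 * (formW φ).length + 4) := by
  unfold initPass
  have h1 := runs_copyToG (a := kr KR.fam) (b := kr KR.fam2) (t₁ := kr KR.t1) (t₂ := kr KR.t2)
    (by decide) (by decide) (by decide) (by decide) (by decide) (by decide) (st ρ)
    (by simp [ht1]) (by simp [ht2]) (by simp [hfam2])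
  simp only [st_fam, update_st_fam2] at h1
  have h2 := (segRuns_init_clauses ρ hpr φ.clauses [] [] cs).runs_loop_nil (by simp)
  have e : st { ρ with fam2 := ρ.fam } =
      st { ρ with fam2 := φ.clauses.flatMap clauseW ++ [], vt := cbody [], inp := cs.map Γ'.bit } := by
    cases ρ; simp only at hvt hinp hfam; subst hvt hinp hfam; simp [formW]
  rw [e] at h1
  have e' : st { ρ with vt := cbody (initL (occs φ) [] cs).1, inp := (initL (occs φ) [] cs).2.map Γ'.bit } =
      st { ρ with
        fam2 := ([] : List Γ'), vt := cbody (initL (φ.clauses.flatMap fun c => c.map Prod.fst) [] cs).1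
        inp := (initL (φ.clauses.flatMap fun c => c.map Prod.fst) [] cs).2.map Γ'.bit } := by
    cases ρ; simp only at hfam2; subst hfam2; rfl
  rw [e']
  refine (h1.seq h2).of_eq rfl ?_
  simp [formW, hfam]; omega


/-! ### Flipping the chosen literal of the violated clause -/

/-- The entry of a literal `l` of the violated clause as staged in `cl` (before its closing `blank`):
a comma, the reversed index bits, the *flipped* value of its variable under the current list `L`.
[folklore] -/
def entryW (L : List Lit) (l : ℕ × Bool) : List Γ' := Γ'.comma :: (rbits l.1 ++ [Γ'.bit (!Asg.val L l.1)])

/-- No `blank` inside an entry. [folklore] -/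
theorem blank_not_mem_entryW (L : List Lit) (l : ℕ × Bool) : Γ'.blank ∉ entryW L l := by
  simp [entryW, rbits]

/-- An entry, reversed, is the code of the flipped literal. [folklore] -/
theorem reverse_entryW (L : List Lit) (l : ℕ × Bool) :
    (entryW L l).reverse = KCNF.encodeLiteral (l.1, !Asg.val L l.1) := by
  simp [entryW, rbits, KCNF.encodeLiteral]

/-- The literal list after the choice `u` in the violated clause `C`: the `u`-th literal's variable
flipped (prepended with the opposite value), nothing if `u ≥ |C|` (`SchoeningCoin.stepL`). [folklore] -/
def pickL (L : List Lit) (C : List (ℕ × Bool)) (u : ℕ) : List Lit :=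
  if h : u < C.length then ((C.get ⟨u, h⟩).1, !Asg.val L (C.get ⟨u, h⟩).1) :: L else L

/-- `stepL` is `pickL` on the first violated clause. [folklore] -/
theorem stepL_eq_pickL {k : ℕ} (φ : KCNF k) (L : List Lit) (u : ℕ) {C : List (ℕ × Bool)}
    (hC : viol φ (Asg.val L) = some C) : stepL φ L u = pickL L C u := by
  unfold stepL pickL flipVar
  rw [hC]

/-- The entry counter during `pick u` after `n` entries: counting down to the chosen one, then a
full stock. [folklore] -/
def iuW (k u n : ℕ) : List Γ' :=
  if n ≤ u then List.replicate (u - n) Γ'.blank else List.replicate (k + 2 + u - n) Γ'.blank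

/-- The assignment register during `pick u` after `n` entries. [folklore] -/
def vtW (L : List Lit) (C : List (ℕ × Bool)) (u n : ℕ) : List Γ' :=
  if u < n then cbody (pickL L C u) else cbody L

/-- Action of `pick` at the end of an entry (collected reversed in `c`): if the counter `iu` is not
exhausted, drop the entry; otherwise this is the chosen literal — prepend it (in order, through
`t1`) to `vt` and restock the counter so that no later entry is chosen. [folklore] -/
def pickA (k : ℕ) : RProg :=
  pop (kr KR.iu) fun o => match o with
    | some _ => clear (kr KR.c)
    | none => pour (kr KR.c) (kr KR.t1) ;; pour (kr KR.t1) (tb TB.vt) ;;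
        pushList (kr KR.iu) (List.replicate (k + 1) Γ'.blank)

/-- `pick k u`: prepend to the assignment `vt` the flipped `u`-th literal of the clause staged in
`cl` (consumed), nothing if it has at most `u` literals. [cite: SchoeningFOCS1999, Theorem (the algorithm: "flip the value of a uniformly chosen literal of C")] -/
def pick (k u : ℕ) : RProg :=
  pushList (kr KR.iu) (List.replicate u Γ'.blank) ;;
    forEach (kr KR.clw) (kr KR.c) (kr KR.c2) Γ'.blank (fun _ => true) (fun _ => false) (pickA k) ;;
    clear (kr KR.iu)

/-- **Specification of `pick`.** [folklore] -/
theorem runs_pick (k u : ℕ) (ρ : MSt) (L : List Lit) (C : List (ℕ × Bool)) (hCk : C.length ≤ k) :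
    Runs (pick k u)
      (st { ρ with cl := wEntries Γ'.blank (C.map (entryW L)), vt := cbody L, iu := [], c := [], c2 := [], t1 := [] })
      (st { ρ with cl := [], vt := cbody (pickL L C u), iu := [], c := [], c2 := [], t1 := [] })
      ((6 * (wEntries Γ'.blank (C.map (entryW L))).length + k + 7) * k +
        3 * (wEntries Γ'.blank (C.map (entryW L))).length + 3 * u + 2 * k + 5) := by
  set T := (wEntries Γ'.blank (C.map (entryW L))).length with hT
  set S : List (ℕ × Bool) → RStore := fun pre =>
    st { ρ with cl := [], c := [], c2 := [], iu := iuW k u pre.length, vt := vtW L C u pre.length, t1 := [] } with hS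
  have hlenE : ∀ x ∈ C, (entryW L x).length ≤ T := by
    intro x hx
    rw [hT]
    obtain ⟨pre, sfx, rfl⟩ := List.append_of_mem hx
    simp [wEntries, List.flatMap_append]
    omega
  -- the loop over the entries
  have hloop := runs_forEach (src := kr KR.clw) (c₁ := kr KR.c) (c₂ := kr KR.c2) (by decide) (by decide) (by decide)
    Γ'.blank (fun _ => true) (fun _ => false) (pickA k) (entryW L) S C
    (fun x _ a ha => fun e => blank_not_mem_entryW L x (e ▸ ha)) (6 * T + k + 5) (by
      intro pre x sfx hsplit
      have hxC : x ∈ C := by rw [← hsplit]; simp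
      have hlen : pre.length < C.length := by rw [← hsplit]; simp
      have hxlen := hlenE x hxC
      simp only [hS, List.filter_true, sel₂, Bool.not_true, Bool.false_and, List.filter_false, List.reverse_nil,
        update_st_cl, update_st_c, update_st_c2, List.length_append, List.length_singleton]
      unfold pickA
      rcases Nat.lt_trichotomy pre.length u with hlt | heq | hgt
      · -- before the chosen entry: drop it
        have hiu1 : iuW k u pre.length = Γ'.blank :: iuW k u (pre.length + 1) := by
          unfold iuW
          rw [if_pos hlt.le, if_pos (Nat.succ_le_of_lt hlt),
            show u - pre.length = (u - (pre.length + 1)) + 1 by omega, List.replicate_succ]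
        have hvt1 : vtW L C u (pre.length + 1) = vtW L C u pre.length := by
          unfold vtW; rw [if_neg (by omega), if_neg (by omega)]
        rw [hiu1, hvt1]
        refine (Runs.pop_cons (st_iu _) ((runs_clear (kr KR.c) _).of_eq (by simp) le_rfl)).of_eq rfl ?_
        simp; omega
      · -- the chosen entry: prepend the flipped literal, restock the counter
        have hiu1 : iuW k u pre.length = [] := by unfold iuW; rw [if_pos heq.le]; simp [heq]
        have hiu2 : iuW k u (pre.length + 1) = List.replicate (k + 1) Γ'.blank := by
          unfold iuW; rw [if_neg (by omega)]; congr 1; omega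
        have hvt1 : vtW L C u pre.length = cbody L := by unfold vtW; rw [if_neg (by omega)]
        have hvt2 : vtW L C u (pre.length + 1) = KCNF.encodeLiteral (x.1, !Asg.val L x.1) ++ cbody L := by
          unfold vtW pickL
          have hu : u < C.length := by omega
          rw [if_pos (by omega), dif_pos hu, cbody_cons]
          have hx : C.get ⟨u, hu⟩ = x := by
            simp only [List.get_eq_getElem, ← hsplit]
            rw [List.getElem_append_right (by omega)]
            simp [heq]
          rw [hx]
          simp [Sparsifier.litBody, KCNF.encodeLiteral]
        rw [hiu1, hiu2, hvt1, hvt2, show 6 * T + k + 5 = (6 * T + k + 3) + 2 by ring]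
        refine Runs.pop_nil (st_iu _) ?_
        have p1 := runs_pour (a := kr KR.c) (b := kr KR.t1) (by decide)
          (st { ρ with
            cl := wEntries Γ'.blank (sfx.map (entryW L)), c := (entryW L x).reverse, c2 := [], iu := []
            vt := cbody L, t1 := [] })
        simp only [st_c, st_t1, List.append_nil, List.reverse_reverse, update_st_c, update_st_t1,
          List.length_reverse] at p1
        have p2 := runs_pour (a := kr KR.t1) (b := tb TB.vt) (by decide)
          (st { ρ with
            cl := wEntries Γ'.blank (sfx.map (entryW L)), c := [], c2 := [], iu := [], vt := cbody L
            t1 := entryW L x })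
        simp only [st_t1, st_vt, update_st_t1, update_st_vt, reverse_entryW] at p2
        have p3 := runs_pushList (kr KR.iu) (List.replicate (k + 1) Γ'.blank)
          (st { ρ with
            cl := wEntries Γ'.blank (sfx.map (entryW L)), c := [], c2 := [], iu := []
            vt := KCNF.encodeLiteral (x.1, !Asg.val L x.1) ++ cbody L, t1 := [] })
        simp only [st_iu, List.append_nil, List.reverse_replicate, update_st_iu] at p3
        refine (p1.seq (p2.seq p3)).of_eq rfl ?_
        simp; omega
      · -- after the chosen entry: drop it
        have hiu1 : iuW k u pre.length = Γ'.blank :: iuW k u (pre.length + 1) := by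
          unfold iuW
          rw [if_neg (by omega), if_neg (by omega),
            show k + 2 + u - pre.length = (k + 2 + u - (pre.length + 1)) + 1 by omega, List.replicate_succ]
        have hvt1 : vtW L C u (pre.length + 1) = vtW L C u pre.length := by
          unfold vtW; rw [if_pos (by omega), if_pos (by omega)]
        rw [hiu1, hvt1]
        refine (Runs.pop_cons (st_iu _) ((runs_clear (kr KR.c) _).of_eq (by simp) le_rfl)).of_eq rfl ?_
        simp; omega)
  simp only [hS, update_st_cl, update_st_c, update_st_c2, List.length_nil] at hloop
  have hiu0 : iuW k u 0 = List.replicate u Γ'.blank := by unfold iuW; rw [if_pos (Nat.zero_le u), Nat.sub_zero]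
  have hvt0 : vtW L C u 0 = cbody L := by unfold vtW; rw [if_neg (Nat.not_lt_zero u)]
  have hvtC : vtW L C u C.length = cbody (pickL L C u) := by
    unfold vtW
    by_cases h : u < C.length
    · rw [if_pos h]
    · rw [if_neg h]; unfold pickL; rw [dif_neg h]
  rw [hiu0, hvt0, hvtC] at hloop
  -- assembling: the initial push, the loop, the final clear
  unfold pick
  have h0 := runs_pushList (kr KR.iu) (List.replicate u Γ'.blank)
    (st { ρ with cl := wEntries Γ'.blank (C.map (entryW L)), vt := cbody L, iu := [], c := [], c2 := [], t1 := [] })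
  simp only [st_iu, List.append_nil, List.reverse_replicate, update_st_iu] at h0
  have h2 := runs_clear (kr KR.iu)
    (st { ρ with cl := [], c := [], c2 := [], iu := iuW k u C.length, vt := cbody (pickL L C u), t1 := [] })
  simp only [st_iu, update_st_iu] at h2
  have hiuC : (iuW k u C.length).length ≤ u + k + 1 := by unfold iuW; split_ifs <;> simp <;> omega
  refine (h0.seq (hloop.seq h2)).of_eq rfl ?_
  rw [List.length_replicate]
  have := Nat.mul_le_mul_right (6 * T + k + 5 + 2) hCk
  nlinarith [hiuC, hCk]

end Literature.Computability.FineGrained.SchoeningCoin
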